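import Literature.Analysis.FluidPDE.TorusLinearisedNSShearParallel
import Literature.Analysis.FluidPDE.TorusHeatFourierMultiplier
import Literature.Analysis.FunctionSpaces.TorusGevreyCompactness
import Literature.Analysis.FunctionSpaces.TorusCutoffSymbols
import Literature.Analysis.FunctionSpaces.TorusClassicalNSGluing
import HarnessLib

/-!
# C135 `Siche2026` — face (A) series block, part 1/2: parallel-shear Fourier series and their heat flows

Kit-pool block (ns-claims-typist-10 g3 for typist-11 g4's per-solution kill of `Step4_globalDecoherence`,
Thm 6.28 (51) p. 22, and `Step5_shiftedCoherence`, Thm 7.1 (53) p. 23). Literature-only imports; sub-namespace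
`…Theorems.Siche2026.Series` (no clash with the face-(B) files). Nothing about C135 is asserted here.

§1 GENERIC PARALLEL-SHEAR SERIES. For a scalar coefficient family `c : ℤ³ → ℂ`: the profile
`profile c (x) = Re Σ_k e_k(x) c_k` (`Torus.fourierSynth`) and, for ANY jointly smooth `e₁`-invariant heat flow
`θ` on `[0, T]` (`Torus.exists_parallel_heat` provides one from a smooth `e₁`-invariant datum), the ŷ-polarised
field `u = θ e₁`. Under the hypotheses (spelled out, no bundling) `RapidDecay c`, conjugate symmetry
`conj c_k = c_{−k}` and axis support (`c_k = 0` unless `k₁ = k₂ = 0`): the profile is smooth and depends on `x₀`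
only; `θ e₁` is a CLASSICAL NAVIER–STOKES SOLUTION on `Icc 0 T` with zero force and zero pressure
(`(u·∇)u = θ ∂₁(θe₁) = 0`, `div u = ∂₁θ = 0`; `isClassicalNSSolutionOn_shear_Icc`); and its Fourier coefficients
are `e^{−4π²ν|k|²t} • (c_k • e₁)` when `θ(0) = profile c` (`coeff_shear`, from `Torus.mFourierCoeff_heat_eq_exp_mul`).

§2 THE LACUNARY SUPPORT `{±5^j e₀ : j ∈ ℕ}` (`lacSupp`, `mem_lacSupp_iff`, `eq_of_mem_lacSupp_of_sum_sq`: it meets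
the shell `Σ kᵢ² = 25^j` exactly in `{±5^j e₀}`) the bridges `ax0_eq_vec : ax0 n = ![n,0,0]`,
`smul_e1C_eq : β • e₁ = WithLp.toLp 2 ![0,β,0]`, `freqNormSq_ax0`, and the Gevrey amplitude `amp k = e^{−|k|}`
(`rapidDecay_of_norm_le_amp`, from the tree's `summable_one_add_freqNormSq_pow_mul_exp_neg`).
-/

noncomputable section

-- cell convention (SoloRefute files): the Theorems namespace repeats `NavierStokesRegularity`.
set_option linter.dupNamespace false

open MeasureTheory Finset UnitAddTorus Set
open Literature.Analysis Literature.Analysis.FluidPDE Literature.Analysis.FunctionSpaces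
open Literature.Analysis.FunctionSpaces.Torus

namespace Summit.NavierStokesRegularity.NavierStokesRegularity.Theorems.Siche2026.Series

/-- `ℤ³`. [folklore] -/
abbrev Z3 : Type := Fin 3 → ℤ
/-- `𝕋³`. [folklore] -/
abbrev T3 : Type := UnitAddTorus (Fin 3)
/-- `ℝ³`. [folklore] -/
abbrev E3 : Type := EuclideanSpace ℝ (Fin 3)
/-- `ℂ³`. [folklore] -/
abbrev C3 : Type := EuclideanSpace ℂ (Fin 3)

/-! ## 1. Generic parallel-shear series -/

section Generic

variable (c : Z3 → ℂ)

/-- The complex synthesis `Σ_k e_k(x) c_k`. [folklore] -/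
def profileC : T3 → ℂ := fourierSynth c

/-- The real profile `Re Σ_k e_k(x) c_k`. [folklore] -/
def profile (x : T3) : ℝ := (profileC c x).re

variable {c}

/-- For conjugate-symmetric coefficients the synthesis is real: `conj F(x) = F(x)`. [folklore] -/
theorem conj_profileC (hcj : ∀ k, starRingEnd ℂ (c k) = c (-k)) (x : T3) :
    starRingEnd ℂ (profileC c x) = profileC c x := by
  unfold profileC fourierSynth
  rw [Complex.conj_tsum]
  simp_rw [smul_eq_mul, map_mul, ← mFourier_neg, hcj]
  exact (Equiv.neg (Fin 3 → ℤ)).tsum_eq (fun k => mFourier k x * c k)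

/-- `(profile c x : ℂ) = profileC c x` for conjugate-symmetric `c`. [folklore] -/
theorem ofReal_profile (hcj : ∀ k, starRingEnd ℂ (c k) = c (-k)) (x : T3) :
    (profile c x : ℂ) = profileC c x :=
  Complex.conj_eq_iff_re.mp (conj_profileC hcj x)

/-- **The profile is smooth** for rapidly decaying coefficients. [folklore] -/
theorem isSmooth_profile (hr : RapidDecay c) : IsSmooth (profile c) :=
  (hr.isSmooth_fourierSynth).comp_clm Complex.reCLM

/-- A character `e_k` with `kᵢ = 0` does not see translations along `eᵢ`. [folklore] -/
theorem mFourier_add_single {k : Z3} {i : Fin 3} (hki : k i = 0) (s : UnitAddCircle) (x : T3) :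
    mFourier k (x + Pi.single i s) = mFourier k x := by
  rw [mFourier_apply_add]
  suffices h : mFourier k (Pi.single i s : T3) = 1 by rw [h, mul_one]
  simp only [mFourier, ContinuousMap.coe_mk]
  refine Finset.prod_eq_one fun j _ => ?_
  by_cases hj : j = i
  · subst hj; rw [hki]; simp
  · rw [Pi.single_eq_of_ne hj]; simp

/-- **Invariance**: if `c` lives on the `e₀`-axis, the profile depends on `x₀` only. [folklore] -/
theorem profile_add_single (hax : ∀ k : Z3, k 1 ≠ 0 ∨ k 2 ≠ 0 → c k = 0) {i : Fin 3} (hi : i ≠ 0)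
    (s : UnitAddCircle) (x : T3) : profile c (x + Pi.single i s) = profile c x := by
  suffices h : profileC c (x + Pi.single i s) = profileC c x by rw [profile, profile, h]
  unfold profileC fourierSynth
  refine tsum_congr fun k => ?_
  by_cases hk : k 1 ≠ 0 ∨ k 2 ≠ 0
  · rw [hax k hk, smul_zero, smul_zero]
  · push Not at hk
    have hki : k i = 0 := by
      fin_cases i
      · exact absurd rfl hi
      · exact hk.1
      · exact hk.2
    rw [mFourier_add_single hki]

/-- The Fourier coefficients of the (complexified) profile are `c`. [folklore] -/
theorem mFourierCoeff_profile (hr : RapidDecay c) (hcj : ∀ k, starRingEnd ℂ (c k) = c (-k)) (k : Z3) :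
    mFourierCoeff (fun y => (profile c y : ℂ)) k = c k := by
  rw [show (fun y => (profile c y : ℂ)) = profileC c from funext (ofReal_profile hcj)]
  exact hr.mFourierCoeff_fourierSynth k

/-- The unit vector `e₁ ∈ ℂ³` (ŷ). [folklore] -/
def e1C : C3 := EuclideanSpace.single 1 1

/-- Complexification of a parallel field: `complexify (a • e₁) = (a : ℂ) • e₁`. [folklore] -/
theorem complexify_smul_single (a : ℝ) :
    EuclideanSpace.complexify (a • (EuclideanSpace.single 1 1 : E3)) = (a : ℂ) • e1C := by
  ext i
  rw [EuclideanSpace.complexify_apply, PiLp.smul_apply, PiLp.smul_apply, smul_eq_mul, smul_eq_mul, e1C]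
  by_cases hi : i = 1
  · subst hi; simp
  · simp [hi]

/-- **A parallel shear heat flow is a classical Navier–Stokes solution on `[0, T]`** (zero force, zero
pressure): for `θ` jointly smooth on `[0, T] × 𝕋³`, invariant along `e₁` and solving `∂ₜθ = νΔθ`, the field
`u = θ e₁` has `∂ₜu = νΔu`, `(u·∇)u = θ ∂₁(θ e₁) = 0`, `div u = ∂₁θ = 0` (Drazin 2002 §8.1: parallel flows are
exact solutions). [folklore] -/
theorem isClassicalNSSolutionOn_shear_Icc {ν T : ℝ} (hT : 0 < T) {θ : ℝ → T3 → ℝ}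
    (hθ : IsSmoothSpaceTimeOn (Icc 0 T) θ)
    (hθinv : ∀ t ∈ Icc 0 T, ∀ (s : UnitAddCircle) (x : T3), θ t (x + Pi.single (1 : Fin 3) s) = θ t x)
    (hheat : ∀ t ∈ Icc 0 T, ∀ x, Torus.timeDerivWithin (Icc 0 T) θ t x = ν * Torus.laplacian (θ t) x) :
    IsClassicalNSSolutionOn (Icc 0 T) ν 0 (fun t x => θ t x • (EuclideanSpace.single 1 1 : E3)) (fun _ _ => 0) := by
  set e : E3 := EuclideanSpace.single 1 1 with he
  refine ⟨?_, ?_, ?_, ?_⟩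
  · exact hθ.smul (isSmoothSpaceTimeOn_const (isSmooth_const e) _)
  · exact isSmoothSpaceTimeOn_const (isSmooth_const (0 : ℝ)) _
  · intro t ht x
    have hθt : IsSmooth (θ t) := hθ.isSmooth_slice ht
    have hD : Torus.timeDerivWithin (Icc 0 T) (fun s y => θ s y • e) t x = (Torus.timeDerivWithin (Icc 0 T) θ t x) • e :=
      Torus.timeDerivWithin_smul_const_of_isSmoothSpaceTimeOn hθ (uniqueDiffOn_Icc hT) e ht x
    have hA : Torus.convect (fun y => θ t y • e) (fun y => θ t y • e) x = 0 := by
      rw [Torus.convect_of_parallel ((hθt.smul' (isSmooth_const e)).isContDiff (by simp)) 1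
          (c := θ t x) rfl,
        Torus.partialDeriv_smul_const_of_isContDiff (hθt.isContDiff (by simp)) e 1 x,
        Torus.partialDeriv_eq_zero_of_forall_add_single (hθinv t ht), zero_smul, smul_zero]
    have hL : Torus.laplacian (fun y => θ t y • e) x = (Torus.laplacian (θ t) x) • e :=
      Torus.laplacian_smul_const_of_isSmooth hθt e x
    have hG : gradient ((fun _ _ => (0 : ℝ)) t) x = (0 : E3) := by
      change _root_.gradient (liftAt (fun _ : T3 => (0 : ℝ)) x) 0 = 0
      have : liftAt (fun _ : T3 => (0 : ℝ)) x = fun _ => 0 := by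
        funext w; simp only [liftAt_apply]
      rw [this]
      exact gradient_fun_const _ _
    change Torus.timeDerivWithin (Icc 0 T) (fun s y => θ s y • e) t x + Torus.convect (fun y => θ t y • e) (fun y => θ t y • e) x =
      ν • Torus.laplacian (fun y => θ t y • e) x - gradient ((fun _ _ => (0 : ℝ)) t) x + (0 : ℝ → T3 → E3) t x
    rw [hD, hA, hL, hG, hheat t ht x, add_zero, sub_zero, Pi.zero_apply, Pi.zero_apply, add_zero, mul_smul]
  · intro t ht
    exact Torus.isDivFree_smul_single_of_forall_add_single (hθinv t ht)

/-- **Fourier coefficients along a parallel shear heat flow** started at `profile c`: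
`𝓕(complexify ∘ θ(t) e₁)(k) = e^{−4π²ν|k|²t} • (c_k • e₁)` for `t ∈ [0, T]` (heat multiplier on each character).
[folklore] -/
theorem coeff_shear {ν T : ℝ} (hT : 0 < T) (hr : RapidDecay c) (hcj : ∀ k, starRingEnd ℂ (c k) = c (-k))
    {θ : ℝ → T3 → ℝ} (hθ : IsSmoothSpaceTimeOn (Icc 0 T) θ) (h0 : θ 0 = profile c)
    (hheat : ∀ t ∈ Icc 0 T, ∀ x, Torus.timeDerivWithin (Icc 0 T) θ t x = ν * Torus.laplacian (θ t) x)
    {t : ℝ} (ht : t ∈ Icc 0 T) (k : Z3) :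
    mFourierCoeff (EuclideanSpace.complexify ∘ fun x => θ t x • (EuclideanSpace.single 1 1 : E3)) k =
      ((Real.exp (-(4 * Real.pi ^ 2 * ν * freqNormSq k) * t) : ℝ) : ℂ) • (c k • e1C) := by
  have hfun : (EuclideanSpace.complexify ∘ fun x => θ t x • (EuclideanSpace.single 1 1 : E3)) =
      fun x => (θ t x : ℂ) • e1C := by
    funext x
    exact complexify_smul_single (θ t x)
  rw [hfun, mFourierCoeff_smul_const, Torus.mFourierCoeff_heat_eq_exp_mul hT hθ hheat k ht, sub_zero, h0,
    mFourierCoeff_profile hr hcj, smul_smul]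

end Generic

/-! ## 2. The lacunary support `{±5^j e₀}` and the amplitude weight -/

/-- The lattice vector `n e₀`. [folklore] -/
def ax0 (n : ℤ) : Z3 := Pi.single 0 n

/-- Component `0` of `n e₀`. [folklore] -/
@[simp] theorem ax0_apply_zero (n : ℤ) : ax0 n 0 = n := by simp [ax0]
/-- Component `1` of `n e₀`. [folklore] -/
@[simp] theorem ax0_apply_one (n : ℤ) : ax0 n 1 = 0 := by simp [ax0]
/-- Component `2` of `n e₀`. [folklore] -/
@[simp] theorem ax0_apply_two (n : ℤ) : ax0 n 2 = 0 := by simp [ax0]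

/-- `−(n e₀) = (−n) e₀`. [folklore] -/
theorem neg_ax0 (n : ℤ) : -ax0 n = ax0 (-n) := by
  ext i; fin_cases i <;> simp [ax0]

/-- `Σᵢ (n e₀)ᵢ² = n²`. [folklore] -/
theorem sum_sq_ax0 (n : ℤ) : ∑ i, ax0 n i ^ 2 = n ^ 2 := by
  simp [Fin.sum_univ_three]

/-- Bridge to the `![n, 0, 0]` spelling (refuter-7 g2's `kx n`). [folklore] -/
theorem ax0_eq_vec (n : ℤ) : ax0 n = ![n, 0, 0] := by
  ext i; fin_cases i <;> simp [ax0]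

/-- `|n e₀|² = n²` (the heat factor on the shell is `e^{−4π²ν n² t}`). [folklore] -/
theorem freqNormSq_ax0 (n : ℤ) : freqNormSq (ax0 n) = (n : ℝ) ^ 2 := by
  rw [freqNormSq, Fin.sum_univ_three]
  simp

/-- Bridge to the `WithLp.toLp 2 ![0, β, 0]` spelling (refuter-7 g2's `yC β`): `β • e₁ = (0, β, 0)`. [folklore] -/
theorem smul_e1C_eq (β : ℂ) : β • e1C = WithLp.toLp 2 ![0, β, 0] := by
  ext i; fin_cases i <;> simp [e1C]

/-- The support `{±5^j e₀ : j ∈ ℕ}` of the coefficients. [folklore] -/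
def lacSupp : Set Z3 :=
  {k | k 1 = 0 ∧ k 2 = 0 ∧ ∃ j : ℕ, k 0 = 5 ^ j ∨ k 0 = -(5 ^ j)}

/-- `5^j e₀` lies in the support. [folklore] -/
theorem ax0_pow_mem (j : ℕ) : ax0 (5 ^ j) ∈ lacSupp :=
  ⟨by simp, by simp, j, Or.inl (by simp)⟩

/-- `−5^j e₀` lies in the support. [folklore] -/
theorem ax0_neg_pow_mem (j : ℕ) : ax0 (-(5 ^ j)) ∈ lacSupp :=
  ⟨by simp, by simp, j, Or.inr (by simp)⟩

/-- The support is symmetric. [folklore] -/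
theorem neg_mem_lacSupp {k : Z3} (hk : k ∈ lacSupp) : -k ∈ lacSupp := by
  obtain ⟨h1, h2, j, hj⟩ := hk
  refine ⟨by simp [h1], by simp [h2], j, ?_⟩
  rcases hj with hj | hj
  · exact Or.inr (by simp [hj])
  · exact Or.inl (by simp [hj])

/-- Members of the support have `k₀ ≠ 0`. [folklore] -/
theorem apply_zero_ne_zero_of_mem {k : Z3} (hk : k ∈ lacSupp) : k 0 ≠ 0 := by
  obtain ⟨-, -, j, hj | hj⟩ := hk <;> rw [hj]
  · exact pow_ne_zero _ (by norm_num)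
  · exact neg_ne_zero.mpr (pow_ne_zero _ (by norm_num))

/-- The support, explicitly: `k = ±5^j e₀`. [folklore] -/
theorem mem_lacSupp_iff {k : Z3} :
    k ∈ lacSupp ↔ ∃ j : ℕ, k = ax0 (5 ^ j) ∨ k = ax0 (-(5 ^ j)) := by
  constructor
  · rintro ⟨h1, h2, j, hj⟩
    refine ⟨j, ?_⟩
    rcases hj with hj | hj
    · left; ext i; fin_cases i <;> simp [hj, h1, h2]
    · right; ext i; fin_cases i <;> simp [hj, h1, h2]
  · rintro ⟨j, rfl | rfl⟩
    · exact ax0_pow_mem j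
    · exact ax0_neg_pow_mem j

/-- Off the `e₀`-axis nothing is in the support. [folklore] -/
theorem not_mem_lacSupp_of_off_axis {k : Z3} (hk : k 1 ≠ 0 ∨ k 2 ≠ 0) : k ∉ lacSupp := by
  rintro ⟨h1, h2, -⟩
  rcases hk with h | h
  · exact h h1
  · exact h h2

/-- **The support meets the shell `Σ kᵢ² = 25^j` exactly in `{±5^j e₀}`.** [folklore] -/
theorem eq_of_mem_lacSupp_of_sum_sq {k : Z3} {j : ℕ} (hk : k ∈ lacSupp) (h : ∑ i, k i ^ 2 = 25 ^ j) :
    k = ax0 (5 ^ j) ∨ k = ax0 (-(5 ^ j)) := by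
  obtain ⟨j', hj'⟩ := mem_lacSupp_iff.mp hk
  have hsq : ∑ i, k i ^ 2 = (25 : ℤ) ^ j' := by
    rcases hj' with rfl | rfl <;> rw [sum_sq_ax0] <;> [skip; rw [neg_sq]] <;>
      rw [← pow_mul, mul_comm, pow_mul] <;> norm_num
  have hjj : j' = j := by
    have h25 : (25 : ℤ) ^ j' = 25 ^ j := by rw [← hsq, h]
    have h25' : (25 : ℕ) ^ j' = 25 ^ j := by exact_mod_cast h25
    exact Nat.pow_right_injective (by norm_num) h25'
  subst hjj
  exact hj'

/-- The amplitude weight `e^{−|k|}` (`= b_j = e^{−5^j}` at `k = ±5^j e₀`). [folklore] -/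
def amp (k : Z3) : ℝ := Real.exp (-Real.sqrt (freqNormSq k))

/-- `amp k > 0`. [folklore] -/
theorem amp_pos (k : Z3) : 0 < amp k := Real.exp_pos _

/-- `amp (−k) = amp k`. [folklore] -/
theorem amp_neg (k : Z3) : amp (-k) = amp k := by
  simp [amp, freqNormSq]

/-- `amp (n e₀) = e^{−|n|}`. [folklore] -/
theorem amp_ax0 (n : ℤ) : amp (ax0 n) = Real.exp (-|(n : ℝ)|) := by
  rw [amp, freqNormSq, Fin.sum_univ_three]
  simp [Real.sqrt_sq_eq_abs]

/-- `amp (5^j e₀) = e^{−5^j}`. [folklore] -/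
theorem amp_ax0_pow (j : ℕ) : amp (ax0 (5 ^ j)) = Real.exp (-(5 : ℝ) ^ j) := by
  rw [amp_ax0, Int.cast_pow, Int.cast_ofNat, abs_of_pos (by positivity)]

/-- `amp (−5^j e₀) = e^{−5^j}`. [folklore] -/
theorem amp_ax0_neg_pow (j : ℕ) : amp (ax0 (-(5 ^ j))) = Real.exp (-(5 : ℝ) ^ j) := by
  rw [← neg_ax0, amp_neg, amp_ax0_pow]

/-- **Rapid decay from the Gevrey weight**: any family with `‖c k‖ ≤ e^{−|k|}` decays rapidly. [folklore] -/
theorem rapidDecay_of_norm_le_amp {c : Z3 → ℂ} (hc : ∀ k, ‖c k‖ ≤ amp k) : RapidDecay c := by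
  intro m
  refine Summable.of_nonneg_of_le (fun k => mul_nonneg (one_add_freqNormSq_pow_nonneg k m) (norm_nonneg _))
    (fun k => ?_) (summable_one_add_freqNormSq_pow_mul_exp_neg (d := Fin 3) one_pos m)
  rw [one_mul]
  exact mul_le_mul_of_nonneg_left (hc k) (one_add_freqNormSq_pow_nonneg k m)

end Summit.NavierStokesRegularity.NavierStokesRegularity.Theorems.Siche2026.Series

end
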